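import Summits.HodgeConjecture.HodgeConjecture.Theorems.F0P5TP2StubSPointwise
import Literature.NumberTheory.Automorphic.AutomorphicFormsL2OrbitalSmoothingChart
import Summits.HodgeConjecture.HodgeConjecture.Theorems.F0P2aL2bHolLieSpanPackage
import HarnessLib

/-!
# FLOOR-0 P5 (K-lane), sub-line `F0_P5TP2SpectralProjection` — STUB (S₂) `StubS₂CotFormL2Data`, file 2∕2 (the closer): the `L²` class of a
# cone-holomorphic cotangent form of `U(H)`, `H ∈ M₂(L)`, carries the `L²`-level cotangent data (reproduction, invariances, type, weak Cauchy–Riemann)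

Cell hodgecm-mathlib, FLOOR 0, crux item HLiu418 = stmt-HodgeConjecture-24832; sub-line `Cruxes/HLiu418/Lines/F0_P5TP2SpectralProjection.lean`
(A-p14 (g16) skeleton v0 `ce659ab5fe57535c`, F0P5-plan (g0) SHAPE PASS 02:03:58Z), registered-shape stub `stub_S₂ : StubS₂CotFormL2Data` (:242);
seat F0P2-p02 (g2) (F0P5-plan (g0) deal 02:03:58Z).  PROOF lane (theorems only — no definition, no instance, no notation, no named fact, no
`sorry`), `--supports stmt-HodgeConjecture-24832 --as helper`.  The Lines module is NOT imported: `stubS₂_holds` has the registered body as its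
type BINDER FOR BINDER with the Lines-local bundles unfolded — `G2 L H` ↦ `adelicGroupData L⁺ L c̄ 2 H`, `sec₁` ↦ `adelicSingle … (cmPlace L ι)`,
`Kc₁` ↦ `(ker archAt).map archToAdelic`, the hypothesis structure `IsRegularKernel₁ γ A` ↦ its four fields as four hypotheses, and the conclusion
structure `IsL2CotPair₁ … ν A u` ↦ the nested conjunction `repro ∧ kc ∧ kf ∧ ktype ∧ diffOrbit ∧ weakHol` of its six fields in declaration order
with `kernelOp₁`, `orbitP₁`, `IsWeaklyHol₁` unfolded.  Registrar's fold (A-p06 (H) ∕ A-p18 (S) shape):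
`fun L _ _ _ ι H dV hdV hdV0 t ht g hg hJ hsig hdef h4 𝔣 X hXu hXv hXt γ hγ μ _ _ _ ν _ A hA hrep f hf hmem =>
  let h := F0P5TP2StubS.stubS₂_holds L ι H dV hdV hdV0 t ht g hg hJ hsig hdef h4 𝔣 X hXu hXv hXt γ hγ μ ν A hA.cont hA.supp hA.diff hA.contDeriv hrep f hf hmem;
  ⟨h.1, h.2.1, h.2.2.1, h.2.2.2.1, h.2.2.2.2.1, h.2.2.2.2.2⟩`.

## The mathematics (rank-2 port of the (D)-desk (S); `u = [f]`, `f ∈ holCotForms₂ 𝔣`, `σ_{w₁}H` hermitian)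
* **Pointwise data** (file 1∕2 ★ `Theorems/F0P5TP2StubSPointwise.lean`): the clauses (L), (Kc), (Sm), (H) of ★ `mem_holCotForms₂_iff`, the
  REPRODUCTION `∫ A u · f(x · sec u) dν = f x` ((K₂) at the slice `Φ_x`, `sec 1 = 1`) and the TYPE LAW `f(x · sec κ) = (a k⁻¹) f x`.
* **Transport to `L²`** (`R(a)[f] = [f(· a)]`, ★ `SpectrumJunction.toLp_toQuotFun_mul_right`): `kc`, `kf`, `ktype`.
* **`repro`** in `L²`: the Fubini representative of `∫ A u • R(sec u)[f] dν` (★ p04 `coeFn_integral_smul_rightRegular_toLp_eq_orbitalIntegral`, `U`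
  locally compact as a closed subgroup of `GL₂(ℂ)`, ★ `isClosed_archLocal`) is `[g] ↦ ∫ A u · f(g⁻¹ · sec u) dν = f(g⁻¹) = [f]([g])`.
* **`diffOrbit` ∕ `weakHol` by the KERNEL ROAD** (no Lie-derivative layer): `[f] = T_A [f]`, so the `𝔭`-orbit map is
  `z ↦ R(sec (γ z)) T_A[f]`, differentiable at `0` by differentiation under the `L²`-valued Bochner integral (★ A-p04
  `hasFDerivAt_rightRegular_chart_integral_smul`, chart `e := γ`, `γ(−z) = (γ z)⁻¹` from `γ = exp ∘ X`); its derivative in direction `z` is the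
  smoothing by the probe-derivative kernel (★ `fderiv_rightRegular_chart_integral_smul_apply`), whose Fubini representative at `[g]` is
  `∂_z|₀ f(g⁻¹ · sec (γ z))` (★ `fderiv_orbitalIntegral_chart_apply` + reproduction at the moved base point), `ℂ`-LINEAR in `z` by ★
  `UnitaryCurveCone.probeCR_of_isConeHol` — so the weak Cauchy–Riemann identity holds a.e., hence in `L²`.

HC_CM is proved only modulo the printed citations until rung 0 closes; this file uses no printed citation as a hypothesis.

## References
* [Borel1997] A. Borel, *Automorphic forms on SL₂(ℝ)* (1997), §2.13–2.14, §5.13–§5.14.  [BorelJacquet1979] A. Borel, H. Jacquet, PSPM 33.1 (1979), §4.2, §4.6.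
* [HarishChandraTAMS1953] Harish-Chandra, Trans. AMS 75 (1953), §9.  [Folland1995] G. B. Folland (1995), §3.2.  [BorelWallach2000] Borel–Wallach (2000), VII 2.10.
-/

set_option autoImplicit false

-- the mandated namespace has the single-problem summit's repeated segment (`HodgeConjecture.HodgeConjecture`)
set_option linter.dupNamespace false

noncomputable section

namespace Summit.HodgeConjecture.HodgeConjecture.Cruxes.HLiu418.F0P5TP2StubS

open scoped Matrix ComplexOrder ContDiff Topology
open NumberField NumberField.InfinitePlace MeasureTheory Filter Set
open Literature.NumberTheory.Automorphic Literature.NumberTheory.Automorphic.UnitaryGroup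
open Literature.NumberTheory.Automorphic.UnitaryCurveForms
open Literature.NumberTheory.Automorphic.UnitaryGroup.CotangentForms (toQuotFun toQuotFun_mk)
open Literature.AlgebraicGeometry.ShimuraVarieties
open Summit.HodgeConjecture.HodgeConjecture.Cruxes.H413.SpectrumJunction
open Summit.HodgeConjecture.HodgeConjecture.Cruxes.H413.F0P2aL2bHolLieSpanPackage (invQuot_toQuotFun)
open Summit.HodgeConjecture.HodgeConjecture.Cruxes.HLiu418.F0P5TP2StubSPointwise

/-! ## §3 The `L²` fields: transport, reproduction, the kernel road to differentiability and weak Cauchy–Riemann -/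

section L2

variable {L : Type} [Field L] [NumberField L] [IsCMField L] {ι : L →+* ℂ} {H : Matrix (Fin 2) (Fin 2) L}
  {𝔣 : ConeFrame L H (cmPlace L ι)} {X : ℂ →ₗ[ℝ] Matrix (Fin 2) (Fin 2) ℂ}
  (hXv : ∀ z, X z *ᵥ 𝔣.v₀ = z • 𝔣.t₀) (hXt : ∀ z, ∃ c : ℂ, X z *ᵥ 𝔣.t₀ = c • 𝔣.v₀)
  {γ : ℂ → archLocal L 2 H (cmPlace L ι)}
  (hγ : ∀ z, ((γ z : GL (Fin 2) ℂ) : Matrix (Fin 2) (Fin 2) ℂ) = NormedSpace.exp (X z))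
  {μ : Measure (adelicGroupData (↥(maximalRealSubfield L)) L (IsCMField.complexConj L) 2 H).automorphicQuotient}
  [(adelicGroupData (↥(maximalRealSubfield L)) L (IsCMField.complexConj L) 2 H).IsAutomorphicMeasure μ]
  [MeasurableSpace (archLocal L 2 H (cmPlace L ι))] [BorelSpace (archLocal L 2 H (cmPlace L ι))]
  {ν : Measure (archLocal L 2 H (cmPlace L ι))} [ν.IsHaarMeasure] {A : archLocal L 2 H (cmPlace L ι) → ℂ}
  (hAc : Continuous A) (hAs : HasCompactSupport A)
  (hAd : ∀ u' : archLocal L 2 H (cmPlace L ι), ContDiff ℝ 1 fun z : ℂ => A (γ z * u'))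
  (hAD : Continuous fun p : ℂ × archLocal L 2 H (cmPlace L ι) => fderiv ℝ (fun z : ℂ => A (γ z * p.2)) p.1)
  (hrep : ∀ Φ : Matrix (Fin 2) (Fin 2) ℂ → ℂ, IsConeHol 𝔣 Φ →
    ∫ u, A u * Φ ((u : GL (Fin 2) ℂ) : Matrix (Fin 2) (Fin 2) ℂ) ∂ν = Φ 1)
  {f : (adelicGroupData (↥(maximalRealSubfield L)) L (IsCMField.complexConj L) 2 H).Adelic → ℂ}
  (hf : f ∈ holCotForms₂ (↥(maximalRealSubfield L)) L (IsCMField.complexConj L) H (IsCMField.complexConj_ne_one L)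
    (UnitaryGroup.complexConj_smul_infinitePlace L) (cmPlace L ι) 𝔣)
  (hmem : MemLp (toQuotFun (adelicGroupData (↥(maximalRealSubfield L)) L (IsCMField.complexConj L) 2 H) f) 2 μ)

omit [BorelSpace (archLocal L 2 H (cmPlace L ι))] [ν.IsHaarMeasure] in
include hrep hf in
/-- **Reproduction at a base point**: `∫ A u · f(x · sec u) dν(u) = f x` ((K₂) at the cone-holomorphic slice at `x`; `sec 1 = 1`). [cite: Borel1997, §5.14] -/
theorem integral_mul_slice_eq (x : (adelicGroupData (↥(maximalRealSubfield L)) L (IsCMField.complexConj L) 2 H).Adelic) :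
    ∫ u, A u * f (x * adelicSingle (↥(maximalRealSubfield L)) L (IsCMField.complexConj L) 2 H (IsCMField.complexConj_ne_one L)
        (UnitaryGroup.complexConj_smul_infinitePlace L) (cmPlace L ι) u) ∂ν = f x := by
  obtain ⟨Φ, hΦ, hΦf⟩ := exists_slice hf x
  have h1 : f x = Φ 1 := by
    have := hΦf 1
    rw [map_one, mul_one] at this
    rw [← this]
    rfl
  rw [h1, ← hrep Φ hΦ]
  refine integral_congr_ae (Eventually.of_forall fun u => ?_)
  simp only [hΦf]

include hf in
/-- **The orbit function of `[f]` at a base point is locally integrable** (the continuous slice, read through ★ `invQuot_toQuotFun`). [cite: Folland1995, §3.2] -/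
theorem locallyIntegrable_orbit (ν : Measure (archLocal L 2 H (cmPlace L ι))) [ν.IsHaarMeasure]
    (x : (adelicGroupData (↥(maximalRealSubfield L)) L (IsCMField.complexConj L) 2 H).Adelic) :
    LocallyIntegrable (fun u => invQuot (adelicGroupData (↥(maximalRealSubfield L)) L (IsCMField.complexConj L) 2 H)
      (toQuotFun (adelicGroupData (↥(maximalRealSubfield L)) L (IsCMField.complexConj L) 2 H) f)
      (x * adelicSingle (↥(maximalRealSubfield L)) L (IsCMField.complexConj L) 2 H (IsCMField.complexConj_ne_one L)
        (UnitaryGroup.complexConj_smul_infinitePlace L) (cmPlace L ι) u)) ν := by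
  haveI := locallyCompactSpace_archLocal (L := L) (ι := ι) (H := H)
  rw [invQuot_toQuotFun (leftInv hf)]
  exact (continuous_slice hf x).locallyIntegrable

include hf in
/-- **A smoothing `∫ β u • R(sec u)[f] dν` is represented by the orbital integral** `g ↦ ∫ β u · f(g⁻¹ · sec u) dν` at `[g]`, a.e.
(★ `coeFn_integral_smul_rightRegular_toLp_eq_orbitalIntegral`, `invQuot (toQuotFun f) = f`). [cite: BorelJacquet1979, §4.6] [cite: Folland1995, §3.2] -/
theorem coeFn_integral_smul_rightRegular_toLp (ν : Measure (archLocal L 2 H (cmPlace L ι))) [ν.IsHaarMeasure]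
    {β : archLocal L 2 H (cmPlace L ι) → ℂ} (hβc : Continuous β) (hβs : HasCompactSupport β) :
    ∀ᵐ y ∂μ, ∀ g, (adelicGroupData (↥(maximalRealSubfield L)) L (IsCMField.complexConj L) 2 H).toAutomorphicQuotient g = y →
      ((∫ u, β u • (adelicGroupData (↥(maximalRealSubfield L)) L (IsCMField.complexConj L) 2 H).rightRegular μ
          (adelicSingle (↥(maximalRealSubfield L)) L (IsCMField.complexConj L) 2 H (IsCMField.complexConj_ne_one L)
            (UnitaryGroup.complexConj_smul_infinitePlace L) (cmPlace L ι) u) (hmem.toLp _) ∂ν :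
          (adelicGroupData (↥(maximalRealSubfield L)) L (IsCMField.complexConj L) 2 H).L2 μ) :
        (adelicGroupData (↥(maximalRealSubfield L)) L (IsCMField.complexConj L) 2 H).automorphicQuotient → ℂ) y =
      ∫ u, β u * f (g⁻¹ * adelicSingle (↥(maximalRealSubfield L)) L (IsCMField.complexConj L) 2 H (IsCMField.complexConj_ne_one L)
        (UnitaryGroup.complexConj_smul_infinitePlace L) (cmPlace L ι) u) ∂ν := by
  haveI := locallyCompactSpace_archLocal (L := L) (ι := ι) (H := H)
  haveI := secondCountableTopology_archLocal (L := L) (ι := ι) (H := H)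
  filter_upwards [(adelicGroupData (↥(maximalRealSubfield L)) L (IsCMField.complexConj L) 2 H).coeFn_integral_smul_rightRegular_toLp_eq_orbitalIntegral
    μ ν (continuous_adelicSingle _ _ _ _ _ _ _ _) hβc hβs hmem] with y hy g hg
  rw [hy g hg, invQuot_toQuotFun (leftInv hf)]

include hAc hAs hrep hf in
/-- **`repro` — REPRODUCTION IN `L²`**: `∫ A u • R(sec u)[f] dν(u) = [f]` (the orbital representative at `[g]` is `f(g⁻¹) = [f]([g])` by the pointwise
reproduction). [cite: Borel1997, §2.13–2.14] [cite: BorelJacquet1979, §4.6] -/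
theorem repro :
    (∫ u, A u • (adelicGroupData (↥(maximalRealSubfield L)) L (IsCMField.complexConj L) 2 H).rightRegular μ
        (adelicSingle (↥(maximalRealSubfield L)) L (IsCMField.complexConj L) 2 H (IsCMField.complexConj_ne_one L)
          (UnitaryGroup.complexConj_smul_infinitePlace L) (cmPlace L ι) u) (hmem.toLp _) ∂ν) = hmem.toLp _ := by
  apply Lp.ext
  filter_upwards [coeFn_integral_smul_rightRegular_toLp hf hmem ν hAc hAs, hmem.coeFn_toLp] with y hy hcoe
  obtain ⟨g, rfl⟩ := toAutomorphicQuotient_surjective y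
  rw [hy g rfl, integral_mul_slice_eq hrep hf g⁻¹, hcoe, toQuotFun_mk (leftInv hf)]

omit [MeasurableSpace (archLocal L 2 H (cmPlace L ι))] [BorelSpace (archLocal L 2 H (cmPlace L ι))] in
include hf in
/-- **`kc`** — right `K_c`-invariance in `L²`. [cite: BorelJacquet1979, §4.2 and §4.6] -/
theorem kc {k : (adelicGroupData (↥(maximalRealSubfield L)) L (IsCMField.complexConj L) 2 H).Adelic}
    (hk : k ∈ ((archAt (↥(maximalRealSubfield L)) L (IsCMField.complexConj L) 2 H (cmPlace L ι)
      (UnitaryGroup.complexConj_smul_infinitePlace L (cmPlace L ι).1) (IsCMField.complexConj_ne_one L)).ker).map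
        (archToAdelic (↥(maximalRealSubfield L)) L (IsCMField.complexConj L) 2 H)) :
    (adelicGroupData (↥(maximalRealSubfield L)) L (IsCMField.complexConj L) 2 H).rightRegular μ k (hmem.toLp _) = hmem.toLp _ := by
  have e : (fun x => f (x * k)) = f := funext fun x => apply_mul_kc hf hk x
  have hmem' : MemLp (toQuotFun (adelicGroupData (↥(maximalRealSubfield L)) L (IsCMField.complexConj L) 2 H) fun x => f (x * k)) 2 μ := by
    rw [e]; exact hmem
  rw [← toLp_toQuotFun_mul_right (leftInv hf) k hmem hmem']
  exact MemLp.toLp_congr hmem' hmem (Eventually.of_forall fun y => by rw [e])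

omit [MeasurableSpace (archLocal L 2 H (cmPlace L ι))] [BorelSpace (archLocal L 2 H (cmPlace L ι))] in
include hf in
/-- **`kf`** — invariance under ONE open `K_f ≤ U(H)(𝔸_{L⁺,f})` in `L²`. [cite: BorelJacquet1979, §4.2 and §4.6] -/
theorem kf : ∃ Kf : Subgroup (finAdelic (↥(maximalRealSubfield L)) L (IsCMField.complexConj L) 2 H),
    IsOpen (Kf : Set (finAdelic (↥(maximalRealSubfield L)) L (IsCMField.complexConj L) 2 H)) ∧
      ∀ k ∈ Kf, (adelicGroupData (↥(maximalRealSubfield L)) L (IsCMField.complexConj L) 2 H).rightRegular μ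
        (finAdelicToAdelic (↥(maximalRealSubfield L)) L (IsCMField.complexConj L) 2 H k) (hmem.toLp _) = hmem.toLp _ := by
  obtain ⟨Kf, hopen, hKf⟩ := exists_open_kf hf
  refine ⟨Kf, hopen, fun k hk => ?_⟩
  have e : (fun x => f (x * finAdelicToAdelic (↥(maximalRealSubfield L)) L (IsCMField.complexConj L) 2 H k)) = f :=
    funext fun x => hKf k hk x
  have hmem' : MemLp (toQuotFun (adelicGroupData (↥(maximalRealSubfield L)) L (IsCMField.complexConj L) 2 H)
      fun x => f (x * finAdelicToAdelic (↥(maximalRealSubfield L)) L (IsCMField.complexConj L) 2 H k)) 2 μ := by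
    rw [e]; exact hmem
  rw [← toLp_toQuotFun_mul_right (leftInv hf) _ hmem hmem']
  exact MemLp.toLp_congr hmem' hmem (Eventually.of_forall fun y => by rw [e])

omit [MeasurableSpace (archLocal L 2 H (cmPlace L ι))] [BorelSpace (archLocal L 2 H (cmPlace L ι))] in
include hf in
/-- **`ktype`** — the cotangent `K_∞`-type relation in `L²`: `R(sec κ)[f] = (a k⁻¹) • [f]`. [cite: BorelJacquet1979, §4.2] [cite: Borel1997, §5.14] -/
theorem ktype (κ : archLocal L 2 H (cmPlace L ι)) (a k d : ℂ) (hk : k ≠ 0)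
    (hκv : ((κ : GL (Fin 2) ℂ) : Matrix (Fin 2) (Fin 2) ℂ) *ᵥ 𝔣.v₀ = k • 𝔣.v₀)
    (hκt : ((κ : GL (Fin 2) ℂ) : Matrix (Fin 2) (Fin 2) ℂ) *ᵥ 𝔣.t₀ = a • 𝔣.t₀ + d • 𝔣.v₀) :
    (adelicGroupData (↥(maximalRealSubfield L)) L (IsCMField.complexConj L) 2 H).rightRegular μ
        (adelicSingle (↥(maximalRealSubfield L)) L (IsCMField.complexConj L) 2 H (IsCMField.complexConj_ne_one L)
          (UnitaryGroup.complexConj_smul_infinitePlace L) (cmPlace L ι) κ) (hmem.toLp _) = (a * k⁻¹) • hmem.toLp _ := by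
  have e : (fun x => f (x * adelicSingle (↥(maximalRealSubfield L)) L (IsCMField.complexConj L) 2 H (IsCMField.complexConj_ne_one L)
      (UnitaryGroup.complexConj_smul_infinitePlace L) (cmPlace L ι) κ)) = (a * k⁻¹) • f :=
    funext fun x => by rw [Pi.smul_apply, smul_eq_mul]; exact apply_mul_sec_eq hf κ a k d hk hκv hκt x
  have hmem' : MemLp (toQuotFun (adelicGroupData (↥(maximalRealSubfield L)) L (IsCMField.complexConj L) 2 H)
      fun x => f (x * adelicSingle (↥(maximalRealSubfield L)) L (IsCMField.complexConj L) 2 H (IsCMField.complexConj_ne_one L)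
        (UnitaryGroup.complexConj_smul_infinitePlace L) (cmPlace L ι) κ)) 2 μ := by
    rw [e]; exact hmem.const_smul _
  rw [← toLp_toQuotFun_mul_right (leftInv hf) _ hmem hmem', ← MemLp.toLp_const_smul]
  exact MemLp.toLp_congr hmem' (hmem.const_smul _) (Eventually.of_forall fun y => by rw [e]; rfl)

include hγ hAc hAs hAd hAD hrep hf in
/-- **`diffOrbit` by the KERNEL ROAD**: the `𝔭`-orbit map `z ↦ R(sec (γ z))[f]` has a derivative at `0` — `[f] = ∫ A u • R(sec u)[f] dν` (`repro`) is a
smoothed class, and smoothed classes have differentiable orbit maps along the chart `γ` (★ `hasFDerivAt_rightRegular_chart_integral_smul`).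
[cite: HarishChandraTAMS1953, §9] [cite: Borel1997, Thm. 2.13] -/
theorem hasFDerivAt_orbit :
    HasFDerivAt (fun z : ℂ => (adelicGroupData (↥(maximalRealSubfield L)) L (IsCMField.complexConj L) 2 H).rightRegular μ
        (adelicSingle (↥(maximalRealSubfield L)) L (IsCMField.complexConj L) 2 H (IsCMField.complexConj_ne_one L)
          (UnitaryGroup.complexConj_smul_infinitePlace L) (cmPlace L ι) (γ z)) (hmem.toLp _))
      (∫ u, (fderiv ℝ (fun z' : ℂ => A ((γ z')⁻¹ * u)) 0).smulRight
        ((adelicGroupData (↥(maximalRealSubfield L)) L (IsCMField.complexConj L) 2 H).rightRegular μ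
          (adelicSingle (↥(maximalRealSubfield L)) L (IsCMField.complexConj L) 2 H (IsCMField.complexConj_ne_one L)
            (UnitaryGroup.complexConj_smul_infinitePlace L) (cmPlace L ι) u) (hmem.toLp _)) ∂ν) 0 := by
  haveI := locallyCompactSpace_archLocal (L := L) (ι := ι) (H := H)
  haveI := secondCountableTopology_archLocal (L := L) (ι := ι) (H := H)
  have h := (adelicGroupData (↥(maximalRealSubfield L)) L (IsCMField.complexConj L) 2 H).hasFDerivAt_rightRegular_chart_integral_smul μ ν
    (continuous_probe_and_neg hγ).1 (probe_neg hγ) (continuous_adelicSingle (↥(maximalRealSubfield L)) L (IsCMField.complexConj L) 2 H (IsCMField.complexConj_ne_one L)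
      (UnitaryGroup.complexConj_smul_infinitePlace L) (cmPlace L ι)) hAc hAs hAd hAD (hmem.toLp _)
  rw [repro hAc hAs hrep hf hmem] at h
  exact h

include hγ hAc hAs hAd hAD hrep hf in
/-- `diffOrbit` as registered: `DifferentiableAt ℝ (orbitP₁ … [f]) 0`. [cite: Borel1997, Thm. 2.13 and §5.14] -/
theorem diffOrbit :
    DifferentiableAt ℝ (fun z : ℂ => (adelicGroupData (↥(maximalRealSubfield L)) L (IsCMField.complexConj L) 2 H).rightRegular μ
        (adelicSingle (↥(maximalRealSubfield L)) L (IsCMField.complexConj L) 2 H (IsCMField.complexConj_ne_one L)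
          (UnitaryGroup.complexConj_smul_infinitePlace L) (cmPlace L ι) (γ z)) (hmem.toLp _)) 0 :=
  (hasFDerivAt_orbit hγ hAc hAs hAd hAD hrep hf hmem).differentiableAt

include hγ hAc hAs hAd hAD hrep hf in
/-- **The derivative of the orbit map in direction `z` is the smoothing by the derivative kernel** `u ↦ D|₀ (z' ↦ A((γ z')⁻¹ u)) z`.
[cite: HarishChandraTAMS1953, §9] [cite: Borel1997, Thm. 2.13] -/
theorem fderiv_orbit_apply (z : ℂ) :
    fderiv ℝ (fun z : ℂ => (adelicGroupData (↥(maximalRealSubfield L)) L (IsCMField.complexConj L) 2 H).rightRegular μ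
        (adelicSingle (↥(maximalRealSubfield L)) L (IsCMField.complexConj L) 2 H (IsCMField.complexConj_ne_one L)
          (UnitaryGroup.complexConj_smul_infinitePlace L) (cmPlace L ι) (γ z)) (hmem.toLp _)) 0 z =
      ∫ u, fderiv ℝ (fun z' : ℂ => A ((γ z')⁻¹ * u)) 0 z •
        (adelicGroupData (↥(maximalRealSubfield L)) L (IsCMField.complexConj L) 2 H).rightRegular μ
          (adelicSingle (↥(maximalRealSubfield L)) L (IsCMField.complexConj L) 2 H (IsCMField.complexConj_ne_one L)
            (UnitaryGroup.complexConj_smul_infinitePlace L) (cmPlace L ι) u) (hmem.toLp _) ∂ν := by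
  haveI := locallyCompactSpace_archLocal (L := L) (ι := ι) (H := H)
  haveI := secondCountableTopology_archLocal (L := L) (ι := ι) (H := H)
  have h := (adelicGroupData (↥(maximalRealSubfield L)) L (IsCMField.complexConj L) 2 H).fderiv_rightRegular_chart_integral_smul_apply μ ν
    (continuous_probe_and_neg hγ).1 (probe_neg hγ) (continuous_adelicSingle (↥(maximalRealSubfield L)) L (IsCMField.complexConj L) 2 H (IsCMField.complexConj_ne_one L)
      (UnitaryGroup.complexConj_smul_infinitePlace L) (cmPlace L ι)) hAc hAs hAd hAD (hmem.toLp _) z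
  rw [repro hAc hAs hrep hf hmem] at h
  exact h

include hγ hAc hAs hAd hAD hrep hf in
/-- **The representative of the derivative is the probe derivative of `f`**: at a base point `x`,
`∫ (D|₀ (z' ↦ A((γ z')⁻¹ u)) z) · f(x · sec u) dν(u) = D|₀ (z' ↦ f(x · sec(γ z'))) z` — differentiate the reproduction identity
`∫ A u · f(x · sec(γ z') · sec u) dν = f(x · sec (γ z'))` at `z' = 0` (★ `fderiv_orbitalIntegral_chart_apply`). [cite: HarishChandraTAMS1953, §9]
[cite: Borel1997, §2.13 and §5.14] -/
theorem integral_derivKernel_mul_slice_eq (x : (adelicGroupData (↥(maximalRealSubfield L)) L (IsCMField.complexConj L) 2 H).Adelic) (z : ℂ) :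
    ∫ u, fderiv ℝ (fun z' : ℂ => A ((γ z')⁻¹ * u)) 0 z *
        f (x * adelicSingle (↥(maximalRealSubfield L)) L (IsCMField.complexConj L) 2 H (IsCMField.complexConj_ne_one L)
          (UnitaryGroup.complexConj_smul_infinitePlace L) (cmPlace L ι) u) ∂ν =
      fderiv ℝ (fun z' : ℂ => f (x * adelicSingle (↥(maximalRealSubfield L)) L (IsCMField.complexConj L) 2 H (IsCMField.complexConj_ne_one L)
          (UnitaryGroup.complexConj_smul_infinitePlace L) (cmPlace L ι) (γ z'))) 0 z := by
  haveI := locallyCompactSpace_archLocal (L := L) (ι := ι) (H := H)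
  haveI := secondCountableTopology_archLocal (L := L) (ι := ι) (H := H)
  have hx := locallyIntegrable_orbit hf ν x
  have h := (adelicGroupData (↥(maximalRealSubfield L)) L (IsCMField.complexConj L) 2 H).fderiv_orbitalIntegral_chart_apply ν
    (continuous_probe_and_neg hγ).1 (probe_neg hγ) hAc hAs hAd hAD _ hx 0 z
  rw [invQuot_toQuotFun (leftInv hf)] at h
  -- the orbital integral at the moved base point `x · sec(γ z')` reproduces `f` there
  have hfun : (fun b : ℂ => ∫ u, A u * f (x * adelicSingle (↥(maximalRealSubfield L)) L (IsCMField.complexConj L) 2 H (IsCMField.complexConj_ne_one L)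
          (UnitaryGroup.complexConj_smul_infinitePlace L) (cmPlace L ι) (γ b) * adelicSingle (↥(maximalRealSubfield L)) L (IsCMField.complexConj L) 2 H (IsCMField.complexConj_ne_one L)
          (UnitaryGroup.complexConj_smul_infinitePlace L) (cmPlace L ι) u) ∂ν) =
      fun z' : ℂ => f (x * adelicSingle (↥(maximalRealSubfield L)) L (IsCMField.complexConj L) 2 H (IsCMField.complexConj_ne_one L)
          (UnitaryGroup.complexConj_smul_infinitePlace L) (cmPlace L ι) (γ z')) := by
    funext z'
    simpa only [mul_assoc] using integral_mul_slice_eq hrep hf (x * adelicSingle (↥(maximalRealSubfield L)) L (IsCMField.complexConj L) 2 H (IsCMField.complexConj_ne_one L)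
          (UnitaryGroup.complexConj_smul_infinitePlace L) (cmPlace L ι) (γ z'))
  rw [hfun] at h
  exact h.symm

omit [MeasurableSpace (archLocal L 2 H (cmPlace L ι))] [BorelSpace (archLocal L 2 H (cmPlace L ι))] in
include hXv hXt hγ hf in
/-- **The probe of `f` at every base point has a `ℂ`-linear differential at `0`** (★ `UnitaryCurveCone.probeCR_of_isConeHol` on the slice, `u = 1`).
[cite: Borel1997, §5.13–§5.14] -/
theorem fderiv_probe_I_smul (x : (adelicGroupData (↥(maximalRealSubfield L)) L (IsCMField.complexConj L) 2 H).Adelic) (z : ℂ) :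
    fderiv ℝ (fun z' : ℂ => f (x * adelicSingle (↥(maximalRealSubfield L)) L (IsCMField.complexConj L) 2 H (IsCMField.complexConj_ne_one L)
        (UnitaryGroup.complexConj_smul_infinitePlace L) (cmPlace L ι) (γ z'))) 0 (Complex.I • z) =
      Complex.I • fderiv ℝ (fun z' : ℂ => f (x * adelicSingle (↥(maximalRealSubfield L)) L (IsCMField.complexConj L) 2 H
        (IsCMField.complexConj_ne_one L) (UnitaryGroup.complexConj_smul_infinitePlace L) (cmPlace L ι) (γ z'))) 0 z := by
  obtain ⟨Φ, hΦ, hΦf⟩ := exists_slice hf x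
  have hfun : (fun z' : ℂ => f (x * adelicSingle (↥(maximalRealSubfield L)) L (IsCMField.complexConj L) 2 H (IsCMField.complexConj_ne_one L)
      (UnitaryGroup.complexConj_smul_infinitePlace L) (cmPlace L ι) (γ z'))) =
      fun z' : ℂ => Φ ((((1 : archLocal L 2 H (cmPlace L ι)) : GL (Fin 2) ℂ) : Matrix (Fin 2) (Fin 2) ℂ) * NormedSpace.exp (X z')) := by
    funext z'
    rw [← hΦf (γ z'), hγ z']
    simp
  rw [hfun]
  exact (UnitaryCurveCone.probeCR_of_isConeHol 𝔣 X hXv hXt hΦ 1).2 z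

include hXv hXt hγ hAc hAs hAd hAD hrep hf in
/-- **`weakHol` — WEAK CAUCHY–RIEMANN**: the differential at `0` of the `𝔭`-orbit map of `[f]` is `ℂ`-linear.  Both sides are smoothed classes
(`fderiv_orbit_apply`) whose orbital representatives (`coeFn_integral_smul_rightRegular_toLp` with the derivative kernels) are the probe derivatives of
`f` (`integral_derivKernel_mul_slice_eq`), which satisfy Cauchy–Riemann pointwise (`fderiv_probe_I_smul`). [cite: Borel1997, §5.14] [cite: BorelWallach2000, VII 2.10] -/
theorem weakHol (z : ℂ) :
    fderiv ℝ (fun z : ℂ => (adelicGroupData (↥(maximalRealSubfield L)) L (IsCMField.complexConj L) 2 H).rightRegular μ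
        (adelicSingle (↥(maximalRealSubfield L)) L (IsCMField.complexConj L) 2 H (IsCMField.complexConj_ne_one L)
          (UnitaryGroup.complexConj_smul_infinitePlace L) (cmPlace L ι) (γ z)) (hmem.toLp _)) 0 (Complex.I • z) =
      Complex.I • fderiv ℝ (fun z : ℂ => (adelicGroupData (↥(maximalRealSubfield L)) L (IsCMField.complexConj L) 2 H).rightRegular μ
        (adelicSingle (↥(maximalRealSubfield L)) L (IsCMField.complexConj L) 2 H (IsCMField.complexConj_ne_one L)
          (UnitaryGroup.complexConj_smul_infinitePlace L) (cmPlace L ι) (γ z)) (hmem.toLp _)) 0 z := by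
  haveI := locallyCompactSpace_archLocal (L := L) (ι := ι) (H := H)
  rw [fderiv_orbit_apply hγ hAc hAs hAd hAD hrep hf hmem, fderiv_orbit_apply hγ hAc hAs hAd hAD hrep hf hmem]
  -- the two derivative kernels are continuous and compactly supported
  have hc : ∀ w : ℂ, Continuous fun u : archLocal L 2 H (cmPlace L ι) => fderiv ℝ (fun z' : ℂ => A ((γ z')⁻¹ * u)) 0 w := fun w =>
    OrbitalSmoothingChart.continuous_fderiv_comp_chart_inv_mul_apply (probe_neg hγ) hAd hAD 0 w
  have hs : ∀ w : ℂ, HasCompactSupport fun u : archLocal L 2 H (cmPlace L ι) => fderiv ℝ (fun z' : ℂ => A ((γ z')⁻¹ * u)) 0 w := fun w =>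
    OrbitalSmoothingChart.hasCompactSupport_fderiv_comp_chart_inv_mul_apply (continuous_probe_and_neg hγ).1 hAs 0 w
  apply Lp.ext
  filter_upwards [coeFn_integral_smul_rightRegular_toLp hf hmem ν (hc (Complex.I • z)) (hs (Complex.I • z)),
    coeFn_integral_smul_rightRegular_toLp hf hmem ν (hc z) (hs z),
    Lp.coeFn_smul Complex.I (∫ u, fderiv ℝ (fun z' : ℂ => A ((γ z')⁻¹ * u)) 0 z •
      (adelicGroupData (↥(maximalRealSubfield L)) L (IsCMField.complexConj L) 2 H).rightRegular μ
        (adelicSingle (↥(maximalRealSubfield L)) L (IsCMField.complexConj L) 2 H (IsCMField.complexConj_ne_one L)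
          (UnitaryGroup.complexConj_smul_infinitePlace L) (cmPlace L ι) u) (hmem.toLp _) ∂ν)] with y hyI hy hsm
  obtain ⟨g, rfl⟩ := toAutomorphicQuotient_surjective y
  rw [hsm, Pi.smul_apply, hyI g rfl, hy g rfl, integral_derivKernel_mul_slice_eq hγ hAc hAs hAd hAD hrep hf g⁻¹,
    integral_derivKernel_mul_slice_eq hγ hAc hAs hAd hAD hrep hf g⁻¹, fderiv_probe_I_smul hXv hXt hγ hf, smul_eq_mul]

end L2

/-! ## §4 The closer: stub (S₂) with the Lines-local bundles unfolded -/

/-- **(S₂) `[f]` carries the rank-2 `L²`-level cotangent data** — stub `stub_S₂ : StubS₂CotFormL2Data` of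
`Cruxes/HLiu418/Lines/F0_P5TP2SpectralProjection.lean` (skeleton v0 ce659ab5fe57535c, :242), body VERBATIM with the Lines-local bundles unfolded
(`G2 L H` ↦ `adelicGroupData L⁺ L c̄ 2 H`; `sec₁ L ι H` ↦ `adelicSingle … (cmPlace L ι)`; `Kc₁`, `kernelOp₁`, `orbitP₁`, `IsWeaklyHol₁` ↦ their bodies;
the `Prop`-structure `IsRegularKernel₁ γ A` ↦ its four fields `cont supp diff contDeriv` as four hypotheses; the `Prop`-structure `IsL2CotPair₁ … u` ↦ its
six fields `repro kc kf ktype diffOrbit weakHol` IN ORDER as a six-fold conjunction).  For a cone-holomorphic cotangent form `f ∈ holCotForms₂` with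
`L²` class `[f]`: `L²`-reproduction by the kernel `A` (from the (K₂) identity on cone-holomorphic functions), right `K_c`-invariance, invariance under
one open `K_f`, the scalar `K_∞`-type relation, differentiability at `0` of the `𝔭`-orbit map along `γ = exp ∘ X` and weak Cauchy–Riemann — the last
two by the KERNEL ROAD (`[f]` is a smoothed class).  The binders `dV, t, g`, the signature/definiteness/degree hypotheses and `hXu` are carried verbatim
and unused. [cite: Borel1997, Thm. 2.13, §5.14] [cite: BorelJacquet1979, §4.2, §4.6] [cite: HarishChandraTAMS1953, §9] -/
theorem stubS₂_holds :
    ∀ (L : Type) [Field L] [NumberField L] [IsCMField L] (ι : L →+* ℂ) (H : Matrix (Fin 2) (Fin 2) L)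
    (dV : Fin 2 → L) (_hdV : ∀ i, IsCMField.complexConj L (dV i) = dV i) (_hdV0 : ∀ i, dV i ≠ 0)
    (t : L) (_ht : t ≠ 0) (g : GL (Fin 2) L),
    formCongr ((IsCMField.complexConj L : L ≃ₐ[↥(maximalRealSubfield L)] L) : L →+* L) g (t • H) = Matrix.diagonal dV →
    (H.map (cmPlace L ι).1.embedding).IsHermitian →
    (∃ T : GL (Fin 2) ℂ, formCongr (starRingEnd ℂ) T ((Matrix.diagonal dV).map ι) = Matrix.diagonal ![(1 : ℂ), -1]) →
    (∀ τ' : L →+* ℂ, InfinitePlace.mk τ' ≠ InfinitePlace.mk ι → ((Matrix.diagonal dV).map τ').PosDef) →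
    4 ≤ Module.finrank ℚ L →
    ∀ (𝔣 : ConeFrame L H (cmPlace L ι)) (X : ℂ →ₗ[ℝ] Matrix (Fin 2) (Fin 2) ℂ),
      (∀ z, (X z)ᴴ * H.map (cmPlace L ι).1.embedding + H.map (cmPlace L ι).1.embedding * X z = 0) →
      (∀ z, X z *ᵥ 𝔣.v₀ = z • 𝔣.t₀) → (∀ z, ∃ c : ℂ, X z *ᵥ 𝔣.t₀ = c • 𝔣.v₀) →
    ∀ (γ : ℂ → archLocal L 2 H (cmPlace L ι)),
      (∀ z, ((γ z : GL (Fin 2) ℂ) : Matrix (Fin 2) (Fin 2) ℂ) = NormedSpace.exp (X z)) →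
    ∀ (μ : Measure (adelicGroupData (↥(maximalRealSubfield L)) L (IsCMField.complexConj L) 2 H).automorphicQuotient)
      [(adelicGroupData (↥(maximalRealSubfield L)) L (IsCMField.complexConj L) 2 H).IsAutomorphicMeasure μ]
      [MeasurableSpace (archLocal L 2 H (cmPlace L ι))] [BorelSpace (archLocal L 2 H (cmPlace L ι))]
      (ν : Measure (archLocal L 2 H (cmPlace L ι))) [ν.IsHaarMeasure] (A : archLocal L 2 H (cmPlace L ι) → ℂ),
      Continuous A → HasCompactSupport A →
      (∀ u' : archLocal L 2 H (cmPlace L ι), ContDiff ℝ 1 fun z : ℂ => A (γ z * u')) →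
      (Continuous fun p : ℂ × archLocal L 2 H (cmPlace L ι) => fderiv ℝ (fun z : ℂ => A (γ z * p.2)) p.1) →
      (∀ Φ : Matrix (Fin 2) (Fin 2) ℂ → ℂ, IsConeHol 𝔣 Φ → ∫ u, A u * Φ ((u : GL (Fin 2) ℂ) : Matrix (Fin 2) (Fin 2) ℂ) ∂ν = Φ 1) →
    ∀ (f : (adelicGroupData (↥(maximalRealSubfield L)) L (IsCMField.complexConj L) 2 H).Adelic → ℂ),
      f ∈ holCotForms₂ (↥(maximalRealSubfield L)) L (IsCMField.complexConj L) H (IsCMField.complexConj_ne_one L)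
          (UnitaryGroup.complexConj_smul_infinitePlace L) (cmPlace L ι) 𝔣 →
    ∀ hf : MemLp (toQuotFun (adelicGroupData (↥(maximalRealSubfield L)) L (IsCMField.complexConj L) 2 H) f) 2 μ,
      -- `repro` : kernelOp₁ (G2 L H) μ (sec₁ L ι H) ν A u = u
      (∫ u, A u • (adelicGroupData (↥(maximalRealSubfield L)) L (IsCMField.complexConj L) 2 H).rightRegular μ
          (adelicSingle (↥(maximalRealSubfield L)) L (IsCMField.complexConj L) 2 H (IsCMField.complexConj_ne_one L)
            (UnitaryGroup.complexConj_smul_infinitePlace L) (cmPlace L ι) u) (MemLp.toLp (toQuotFun _ f) hf) ∂ν) =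
        MemLp.toLp (toQuotFun _ f) hf ∧
      -- `kc`
      (∀ k ∈ ((archAt (↥(maximalRealSubfield L)) L (IsCMField.complexConj L) 2 H (cmPlace L ι)
          (UnitaryGroup.complexConj_smul_infinitePlace L (cmPlace L ι).1) (IsCMField.complexConj_ne_one L)).ker).map
          (archToAdelic (↥(maximalRealSubfield L)) L (IsCMField.complexConj L) 2 H),
        (adelicGroupData (↥(maximalRealSubfield L)) L (IsCMField.complexConj L) 2 H).rightRegular μ k (MemLp.toLp (toQuotFun _ f) hf) =
          MemLp.toLp (toQuotFun _ f) hf) ∧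
      -- `kf`
      (∃ Kf : Subgroup (finAdelic (↥(maximalRealSubfield L)) L (IsCMField.complexConj L) 2 H),
        IsOpen (Kf : Set (finAdelic (↥(maximalRealSubfield L)) L (IsCMField.complexConj L) 2 H)) ∧
          ∀ k ∈ Kf, (adelicGroupData (↥(maximalRealSubfield L)) L (IsCMField.complexConj L) 2 H).rightRegular μ
            (finAdelicToAdelic (↥(maximalRealSubfield L)) L (IsCMField.complexConj L) 2 H k) (MemLp.toLp (toQuotFun _ f) hf) =
            MemLp.toLp (toQuotFun _ f) hf) ∧
      -- `ktype`
      (∀ (κ : archLocal L 2 H (cmPlace L ι)) (a k d : ℂ), k ≠ 0 →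
        ((κ : GL (Fin 2) ℂ) : Matrix (Fin 2) (Fin 2) ℂ) *ᵥ 𝔣.v₀ = k • 𝔣.v₀ →
        ((κ : GL (Fin 2) ℂ) : Matrix (Fin 2) (Fin 2) ℂ) *ᵥ 𝔣.t₀ = a • 𝔣.t₀ + d • 𝔣.v₀ →
        (adelicGroupData (↥(maximalRealSubfield L)) L (IsCMField.complexConj L) 2 H).rightRegular μ
            (adelicSingle (↥(maximalRealSubfield L)) L (IsCMField.complexConj L) 2 H (IsCMField.complexConj_ne_one L)
              (UnitaryGroup.complexConj_smul_infinitePlace L) (cmPlace L ι) κ) (MemLp.toLp (toQuotFun _ f) hf) =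
          (a * k⁻¹) • MemLp.toLp (toQuotFun _ f) hf) ∧
      -- `diffOrbit` : DifferentiableAt ℝ (orbitP₁ (G2 L H) μ (sec₁ L ι H) γ u) 0
      DifferentiableAt ℝ (fun z : ℂ => (adelicGroupData (↥(maximalRealSubfield L)) L (IsCMField.complexConj L) 2 H).rightRegular μ
          (adelicSingle (↥(maximalRealSubfield L)) L (IsCMField.complexConj L) 2 H (IsCMField.complexConj_ne_one L)
            (UnitaryGroup.complexConj_smul_infinitePlace L) (cmPlace L ι) (γ z)) (MemLp.toLp (toQuotFun _ f) hf)) 0 ∧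
      -- `weakHol` : IsWeaklyHol₁ (G2 L H) μ (sec₁ L ι H) γ u
      (∀ z : ℂ, fderiv ℝ (fun z : ℂ => (adelicGroupData (↥(maximalRealSubfield L)) L (IsCMField.complexConj L) 2 H).rightRegular μ
            (adelicSingle (↥(maximalRealSubfield L)) L (IsCMField.complexConj L) 2 H (IsCMField.complexConj_ne_one L)
              (UnitaryGroup.complexConj_smul_infinitePlace L) (cmPlace L ι) (γ z)) (MemLp.toLp (toQuotFun _ f) hf)) 0 (Complex.I • z) =
        Complex.I • fderiv ℝ (fun z : ℂ => (adelicGroupData (↥(maximalRealSubfield L)) L (IsCMField.complexConj L) 2 H).rightRegular μ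
            (adelicSingle (↥(maximalRealSubfield L)) L (IsCMField.complexConj L) 2 H (IsCMField.complexConj_ne_one L)
              (UnitaryGroup.complexConj_smul_infinitePlace L) (cmPlace L ι) (γ z)) (MemLp.toLp (toQuotFun _ f) hf)) 0 z) := by
  intro L _ _ _ ι H dV _ _ t _ g _ _ _ _ _ 𝔣 X _ hXv hXt γ hγ μ _ _ _ ν _ A hAc hAs hAd hAD hrep f hf hmem
  exact ⟨repro hAc hAs hrep hf hmem, fun k hk => kc hf hmem hk, kf hf hmem, fun κ a k d hk hκv hκt => ktype hf hmem κ a k d hk hκv hκt,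
    diffOrbit hγ hAc hAs hAd hAD hrep hf hmem, fun z => weakHol hXv hXt hγ hAc hAs hAd hAD hrep hf hmem z⟩

end Summit.HodgeConjecture.HodgeConjecture.Cruxes.HLiu418.F0P5TP2StubS

end
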